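import Mathlib
import HarnessLib
import Summits.HubbardSuperconductivity.HubbardSuperconductivity.Theorems.KLProgrammeKLRegimeEngineSliceFamBandTelClosed
import Summits.HubbardSuperconductivity.HubbardSuperconductivity.Theorems.KLProgrammeKLRegimeSectorSliceFamilyDefectFrames
import Summits.HubbardSuperconductivity.HubbardSuperconductivity.Theorems.KLProgrammeKLRegimeTwoVolumeTowerCovPieceJets

/-!
# K3 VL child `KLRegimeVolumeLimitV17F2` (stmt-HubbardSuperconductivity-20440), located item #23 «W2-HALF-VL», COV/SEC shallow half, part 2F: the FAMILY piece of
# one step of the frame telescope IN THE DECAYING CURRENCY — symbol-class level, `klScaleWt`-rows/columns of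
# `S(F̃[K_o])ᵀC^{K_n}S(F̃[K_o]) − S(F̃[K_n])ᵀC^{K_n}S(F̃[K_n])` for two admissible frames whose band increment has the jets of ONE flow piece at depth `4^i`
# (`G₀/16^i, G₀/4^i, G₀, G₀·4^i`, any `0 < G₀ ≤ 1`), weight scale `Λ_{n_w}·4^i ≤ ρ_w`: rows and columns `≤ 𝒦·G₀·(M/β)/(Λ_{m+1+j}²·4^i)`, `𝒦, ρ_w` ABSOLUTE

Cell `gate-hubbard-kl`, seat p3 (g16), lead of #23.  k3c3-p2's closed telescope `famBandTel_closed` (`…EngineSliceFamBandTelClosed`, R1a) re-run for ONE step with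
(i) the increment given by its EUCLIDEAN JETS (the tower's plain flow frames `K_i`; increments = full flow pieces — `HistP klPredsV17F2` carries no mean-free clause),
(ii) the weight constant `D := 1` with the rate `ρ/4^i` (the tower's doors read the `(1 + Λ_w·tnorm)` currency, «W2H-OVL-CURRENCY», p3 g15) so that the step
bound DECAYS like `4^{−i}` instead of being `x`-free, (iii) every `R`-dependence capped (`Gfr₃U ≤ 1`, all increment amplitudes `= G₀`), so that the constants are
absolute as the tower's doors (`∃ Cα` before `∀ R`) require.  Bricks by name: `rowSumWt_sliceCT_familySub_bgmFat_le` (p597679), `famIncr_rates_uniform`,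
`famTel_thresholds_pack`, `famTel_increment_scalar_le'` (covariance slot `:= 0`), `telRegime_lattice/refscale/angular`.  Companion (part 2C): the covariance piece.

* **`famStep_decay_le`** — rows and columns `≤ 𝒦·G₀·(M/β)/(klScale klE0 (m+1+j)²·4^i)`.

Everything is proved; no definitions, no sorry.  Nothing asserts any stub, K3, VL or superconductivity. [cite: BenfattoGiulianiMastropietro2006, §2.8 (2.81), §3 (3.2)–(3.8)]
-/

noncomputable section

namespace Summit.HubbardSuperconductivity.HubbardSuperconductivity.Theorems.TorusFourierL2

set_option linter.dupNamespace false -- summit = problem name (single-conjunct summit), D-0017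

open Set Finset Literature.MathematicalPhysics.QuantumLattice Literature.MathematicalPhysics.QuantumLattice.BandSectorCounting Literature.Probability.LatticeModels
open Literature.MathematicalPhysics.QuantumLattice.FermiRG Literature.Analysis.SpecialFunctions Summit.HubbardSuperconductivity.HubbardSuperconductivity.Theorems.DispersionFlow
open Summit.HubbardSuperconductivity.HubbardSuperconductivity.Theorems.KLRegimeSplit Summit.HubbardSuperconductivity.HubbardSuperconductivity.Theorems.KLProgrammeLegKernels
open Summit.HubbardSuperconductivity.HubbardSuperconductivity.Theorems.PerturbedFermiCurve Summit.HubbardSuperconductivity.HubbardSuperconductivity.Theorems.KLRegimeWick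
open scoped Real Nat

set_option maxHeartbeats 8000000 in
/-- **The family piece of one telescope step in the decaying currency, symbol-class level** (module docstring). [cite: BenfattoGiulianiMastropietro2006, §3 (3.2)–(3.8)] -/
theorem famStep_decay_le (ha : (-4 : ℝ) < -(6 / 5)) (hab : (-(6 / 5) : ℝ) ≤ -(1 / 10)) (hb : (-(1 / 10) : ℝ) < 0) (j : ℕ) :
    ∃ 𝒦 ρw : ℝ, 0 ≤ 𝒦 ∧ 0 < ρw ∧ ∀ (R : RenConsts), (∀ i, 0 ≤ R.Gfr i) → ∀ (c U : ℝ), 0 < c →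
      c ≤ min (min ((bandBounds ha hab hb).Dtmin / 4) ((bandBounds ha hab hb).rhomin / 4)) (1 / 40) / (12 * (R.Gfr 2 + 1)) → 0 < U →
      U ≤ min 1 (min (min ((bandBounds ha hab hb).Dtmin / 4) ((bandBounds ha hab hb).rhomin / 4)) (1 / 40) / (24 * (R.Gfr 0 + R.Gfr 1 + 1))) → R.Gfr 3 * U ≤ 1 →
      ∀ β : ℝ, klBetaMin ≤ β → β ≤ Real.exp (c / U ^ 2) → ∀ μ ∈ klWindowC, ∀ (L M : ℕ) [NeZero L] [NeZero M], β ^ 2 ≤ (L : ℝ) → β ≤ (M : ℝ) →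
      ∀ (Ko Kn : TrigPolyC4v) (i : ℕ), FrameOK R U (nScales β) μ Ko → FrameOK R U (nScales β) μ Kn →
        (∀ p : Momentum, ‖iteratedFDeriv ℝ 3 (frameShift Ko) p‖ ≤ R.Gfr 3 * U ^ 2 * ((4 : ℝ) ^ i / 3)) →
        (∀ p : Momentum, ‖iteratedFDeriv ℝ 3 (frameShift Kn) p‖ ≤ R.Gfr 3 * U ^ 2 * ((4 : ℝ) ^ (i + 1) / 3)) →
        (∀ p : Momentum, ‖iteratedFDeriv ℝ 3 (frameLevel μ Ko) p‖ ≤ 64 + R.Gfr 3 * U ^ 2 * ((4 : ℝ) ^ i / 3)) →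
        (∀ p : Momentum, ‖iteratedFDeriv ℝ 3 (frameLevel μ Kn) p‖ ≤ 64 + R.Gfr 3 * U ^ 2 * ((4 : ℝ) ^ (i + 1) / 3)) →
      ∀ G₀ : ℝ, 0 < G₀ → G₀ ≤ 1 → (∀ p : Momentum, |frameLevel μ Kn p - frameLevel μ Ko p| ≤ G₀ / ((4 : ℝ) ^ i) ^ 2) →
        (∀ p : Momentum, ‖fderiv ℝ (fun q : Momentum => frameLevel μ Kn q - frameLevel μ Ko q) p‖ ≤ G₀ / (4 : ℝ) ^ i) →
        (∀ p : Momentum, ‖iteratedFDeriv ℝ 2 (fun q : Momentum => frameLevel μ Kn q - frameLevel μ Ko q) p‖ ≤ G₀) →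
        (∀ p : Momentum, ‖iteratedFDeriv ℝ 3 (fun q : Momentum => frameLevel μ Kn q - frameLevel μ Ko q) p‖ ≤ G₀ * (4 : ℝ) ^ i) →
      ∀ m : ℕ, m + 1 + j ≤ nScales β + 1 → (4 : ℝ) ^ (j + 4) * (16 : ℝ) ^ (m + 1) ≤ (4 : ℝ) ^ i → ∀ nw : ℕ, klScale klE0 nw * (4 : ℝ) ^ i ≤ ρw →
        (∀ Y : SpaceTimeIdx L M × SectorLeg (sectorCount (m + 1)), ∑ Y' : SpaceTimeIdx L M × SectorLeg (sectorCount (m + 1)),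
            ‖((sectorSubMatrix L M β (bgmFatMultiplier L M klE0 β (nambuXiCT L μ Ko) (m + 1))).transpose * hubbardCovSliceCT L M β μ 0 Kn (klScale klE0 (m + 1 + j)) (klScale klE0 (m + j)) *
                  sectorSubMatrix L M β (bgmFatMultiplier L M klE0 β (nambuXiCT L μ Ko) (m + 1)) -
                (sectorSubMatrix L M β (bgmFatMultiplier L M klE0 β (nambuXiCT L μ Kn) (m + 1))).transpose * hubbardCovSliceCT L M β μ 0 Kn (klScale klE0 (m + 1 + j)) (klScale klE0 (m + j)) *
                  sectorSubMatrix L M β (bgmFatMultiplier L M klE0 β (nambuXiCT L μ Kn) (m + 1))) Y Y'‖ * EngineV8.klScaleWt L M β nw {EngineV8.latticeLegPos (2 * (2 * M)) Y, EngineV8.latticeLegPos (2 * (2 * M)) Y'} ≤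
            𝒦 * G₀ * ((M : ℝ) / β) / (klScale klE0 (m + 1 + j) ^ 2 * (4 : ℝ) ^ i)) ∧
        (∀ Y' : SpaceTimeIdx L M × SectorLeg (sectorCount (m + 1)), ∑ Y : SpaceTimeIdx L M × SectorLeg (sectorCount (m + 1)),
            ‖((sectorSubMatrix L M β (bgmFatMultiplier L M klE0 β (nambuXiCT L μ Ko) (m + 1))).transpose * hubbardCovSliceCT L M β μ 0 Kn (klScale klE0 (m + 1 + j)) (klScale klE0 (m + j)) *
                  sectorSubMatrix L M β (bgmFatMultiplier L M klE0 β (nambuXiCT L μ Ko) (m + 1)) -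
                (sectorSubMatrix L M β (bgmFatMultiplier L M klE0 β (nambuXiCT L μ Kn) (m + 1))).transpose * hubbardCovSliceCT L M β μ 0 Kn (klScale klE0 (m + 1 + j)) (klScale klE0 (m + j)) *
                  sectorSubMatrix L M β (bgmFatMultiplier L M klE0 β (nambuXiCT L μ Kn) (m + 1))) Y Y'‖ * EngineV8.klScaleWt L M β nw {EngineV8.latticeLegPos (2 * (2 * M)) Y, EngineV8.latticeLegPos (2 * (2 * M)) Y'} ≤
            𝒦 * G₀ * ((M : ℝ) / β) / (klScale klE0 (m + 1 + j) ^ 2 * (4 : ℝ) ^ i)) := by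
  -- the window band bounds, `κ₀`, `A := κ₀/4` (as in `alphaWt_klSliceCov_bgmFat_of_thresholds`)
  set B : BandBounds (-(6 / 5)) (-(1 / 10)) := bandBounds ha hab hb with hBdef
  set κ₀ : ℝ := min (min (B.Dtmin / 4) (B.rhomin / 4)) (1 / 40) with hκ₀
  have hDt := B.Dtmin_pos; have hrh := B.rhomin_pos
  have hκ₀pos : 0 < κ₀ := by rw [hκ₀]; exact lt_min (lt_min (by positivity) (by positivity)) (by norm_num)
  have hκ₀Dt : κ₀ ≤ B.Dtmin / 4 := (min_le_left _ _).trans (min_le_left _ _)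
  have hκ₀rh : κ₀ ≤ B.rhomin / 4 := (min_le_left _ _).trans (min_le_right _ _)
  have hκ₀40 : κ₀ ≤ 1 / 40 := min_le_right _ _
  have hrh2 : B.rhomin ≤ 2 := by
    have : B.rhomin = cRhomin (-(6 / 5)) (-(1 / 10)) := rfl
    rw [this]; exact cRhomin_le_two (by norm_num) (by norm_num)
  have he : (0 : ℝ) < klE0 := by norm_num [klE0]
  have he1 : klE0 ≤ 1 := by norm_num [klE0]
  obtain ⟨d₀, hd₀, hd₀1, hd₀2, hd₀3, hd₀4⟩ := exists_abs_derivs4_bgmCutoffSq_le he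
  obtain ⟨B₃a, hB₃a0, hB₃a⟩ := exists_norm_iteratedDeriv_sectorWeightCirc_polarAngle_line_le 3
  set A : ℝ := κ₀ / 4 with hAdef
  have hA0 : 0 < A := by rw [hAdef]; positivity
  have hDtA : 0 < B.Dtmin - 2 * A := by rw [hAdef]; linarith
  have hγ : 0 < 2 * B.rhomin - 4 * A := by rw [hAdef]; linarith
  have hγ4 : 2 * B.rhomin - 4 * A ≤ 4 := by linarith
  have hsm := B.smax_pos; have hπ := Real.pi_pos; have hπ3 := Real.pi_gt_three
  -- the fixed scale-free constants of the telescope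
  obtain ⟨cρ, hcρ⟩ : ∃ y : ℝ, y = (2 * klE0 / π + B.smax * B.Dtmin * (3 / 4)) / (B.Dtmin - 2 * A) + π * Real.sqrt 2 * (1 + (4 + 2 * A) / (B.Dtmin - 2 * A)) := ⟨_, rfl⟩
  obtain ⟨ρfM, hρfM⟩ : ∃ y : ℝ, y = (klE0 + B.smax * B.Dtmin * (3 * (π / 2) / 4)) / (B.Dtmin - 2 * A) + π * Real.sqrt 2 * (1 + (4 + 2 * A) / (B.Dtmin - 2 * A)) * (π / 2) :=
    ⟨_, rfl⟩
  have hcρ0 : 0 < cρ := by rw [hcρ]; positivity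
  have hρfM0 : 0 ≤ ρfM := by rw [hρfM]; positivity
  obtain ⟨T₀, hT₀⟩ : ∃ y : ℝ, y = (4 + 2 * A) / (2 - 1) + 7 * (Real.sqrt 2 * ρfM) := ⟨_, rfl⟩
  have hT₀0 : 0 ≤ T₀ := by rw [hT₀]; norm_num; positivity
  obtain ⟨Q, hQ0, hQ⟩ := famIncr_rates_uniform (T₀ := T₀) (A := A) (ε₂ := 4 + 4 * A) (E₀ := 4) (E₁ := 32 / 3) (e₀ := klE0) (d := d₀)
    (Ba := B₃a) (zc := 1) (g₀ := 1) (g₁ := 1) (g₂ := 1) (g₃ := 1) (γ₁ := 1) (γ₂ := 1) (γ₃ := 1)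
    hT₀0 hA0.le (by positivity) (by norm_num) (by norm_num) hd₀ hB₃a0 zero_le_one zero_le_one zero_le_one zero_le_one zero_le_one
    zero_le_one zero_le_one zero_le_one
  obtain ⟨bs, hbs⟩ : ∃ y : ℝ, y = T₀ + 8 := ⟨_, rfl⟩
  have hbs0 : 0 ≤ bs := by rw [hbs]; positivity
  have h7bs : (7 : ℝ) ≤ bs := by rw [hbs]; linarith
  obtain ⟨ℭ, hℭ⟩ : ∃ y : ℝ, y = (343 * (64 * (44900 : ℝ) + 480 * (448 / 3 * Real.exp 2) + 1728 * (32 / 3 : ℝ) + 1536) * bs ^ 3 +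
      21 * (32 * (448 / 3 * Real.exp 2) + 144 * (32 / 3 : ℝ) + 128) * bs * 7 + (16 * (32 / 3 : ℝ) + 16) * 64 +
        3 * Q * (36 * (32 * (448 / 3 * Real.exp 2) + 144 * (32 / 3 : ℝ) + 128) * bs ^ 2 + (16 * (32 / 3 : ℝ) + 16) * 7) + 15 * Q * (16 * (32 / 3 : ℝ) + 16) * bs + 4 * Q) +
      (21 * (32 * (448 / 3 * Real.exp 2) + 144 * (32 / 3 : ℝ) + 128) * bs * 0 + (16 * (32 / 3 : ℝ) + 16) * (4 / 3 : ℝ) +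
        3 * Q * (36 * (32 * (448 / 3 * Real.exp 2) + 144 * (32 / 3 : ℝ) + 128) * bs ^ 2 + (16 * (32 / 3 : ℝ) + 16) * 7) +
        3 * Q * ((16 * (32 / 3 : ℝ) + 16) * 0) + 15 * Q * (16 * (32 / 3 : ℝ) + 16) * bs + 4 * Q) +
      (3 * Q * ((16 * (32 / 3 : ℝ) + 16) * 0) + 15 * Q * (16 * (32 / 3 : ℝ) + 16) * bs + 4 * Q) + 4 * Q := ⟨_, rfl⟩
  obtain ⟨𝔴, h𝔴⟩ : ∃ y : ℝ, y = (25 * (32 * (448 / 3 * Real.exp 2) + 144 * (32 / 3 : ℝ) + 128) * bs ^ 2 + (16 * (32 / 3 : ℝ) + 16) * 7 +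
      8 * Q * (16 * (32 / 3 : ℝ) + 16) * bs + 4 * Q) + ((16 * (32 / 3 : ℝ) + 16) * 0 + 8 * Q * (16 * (32 / 3 : ℝ) + 16) * bs + 4 * Q) + 4 * Q := ⟨_, rfl⟩
  have hℭ0 : 0 ≤ ℭ := by rw [hℭ]; positivity
  have h𝔴0 : 0 ≤ 𝔴 := by rw [h𝔴]; positivity
  obtain ⟨ρ, hρ⟩ : ∃ y : ℝ, y = min 1 (8 / (π ^ 3 * (ℭ + 1))) := ⟨_, rfl⟩
  obtain ⟨ρ₃, hρ₃⟩ : ∃ y : ℝ, y = min 1 (16 / (π ^ 2 * (3 * 𝔴 + 1))) := ⟨_, rfl⟩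
  have hρ0 : 0 < ρ := by rw [hρ]; exact lt_min one_pos (by positivity)
  have hρ₃0 : 0 < ρ₃ := by rw [hρ₃]; exact lt_min one_pos (by positivity)
  have hρ1 : ρ ≤ 1 := by rw [hρ]; exact min_le_left _ _
  have hρ₃1 : ρ₃ ≤ 1 := by rw [hρ₃]; exact min_le_left _ _
  have hρℭ : ℭ * ρ ^ 3 ≤ 8 / π ^ 3 := by
    have h1 : ρ ^ 3 ≤ ρ := by simpa using pow_le_pow_of_le_one hρ0.le hρ1 (by norm_num : 1 ≤ 3)
    have h2 : ρ ≤ 8 / (π ^ 3 * (ℭ + 1)) := by rw [hρ]; exact min_le_right _ _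
    have h3 : ℭ * (8 / (π ^ 3 * (ℭ + 1))) ≤ 8 / π ^ 3 := by
      rw [mul_div_assoc', div_le_div_iff₀ (by positivity) (by positivity)]; nlinarith only [hℭ0, pow_pos hπ 3]
    exact (mul_le_mul_of_nonneg_left (h1.trans h2) hℭ0).trans h3
  have hρ𝔴 : 3 * 𝔴 * ρ₃ ^ 2 ≤ 16 / π ^ 2 := by
    have h1 : ρ₃ ^ 2 ≤ ρ₃ := by simpa using pow_le_pow_of_le_one hρ₃0.le hρ₃1 (by norm_num : 1 ≤ 2)
    have h2 : ρ₃ ≤ 16 / (π ^ 2 * (3 * 𝔴 + 1)) := by rw [hρ₃]; exact min_le_right _ _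
    have h3 : 3 * 𝔴 * (16 / (π ^ 2 * (3 * 𝔴 + 1))) ≤ 16 / π ^ 2 := by
      rw [mul_div_assoc', div_le_div_iff₀ (by positivity) (by positivity)]; nlinarith only [h𝔴0, pow_pos hπ 2]
    exact (mul_le_mul_of_nonneg_left (h1.trans h2) (by positivity)).trans h3
  obtain ⟨Θt, hΘt⟩ : ∃ y : ℝ, y = (64 * (44900 : ℝ) + 480 * (448 / 3 * Real.exp 2) + 1728 * (32 / 3 : ℝ) + 1536) +
      3 * (2 * klE0 ^ 2 + 2 * (d₀ * klE0 ^ 2)) * (32 * (448 / 3 * Real.exp 2) + 144 * (32 / 3 : ℝ) + 128) +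
      3 * (4 * klE0 ^ 4 + 2 * klE0 ^ 2 + 8 * (d₀ * klE0 ^ 4) + (4 * (d₀ * klE0 ^ 4) + 2 * (d₀ * klE0 ^ 2))) * (16 * (32 / 3 : ℝ) + 16) +
      4 * (8 * klE0 ^ 6 + 12 * klE0 ^ 4 + 6 * (d₀ * klE0 ^ 2) * (4 * klE0 ^ 4 + 2 * klE0 ^ 2) + 6 * klE0 ^ 2 * (4 * (d₀ * klE0 ^ 4) + 2 * (d₀ * klE0 ^ 2)) +
        (8 * (d₀ * klE0 ^ 6) + 12 * (d₀ * klE0 ^ 4))) := ⟨_, rfl⟩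
  have hΘt0 : 0 ≤ Θt := by rw [hΘt]; positivity
  obtain ⟨σ, hσ⟩ : ∃ y : ℝ, y = min 1 (4 / (π ^ 3 * Θt + 4)) := ⟨_, rfl⟩
  have hσ0 : 0 < σ := by rw [hσ]; exact lt_min one_pos (by positivity)
  have hσ1 : σ ≤ 1 := by rw [hσ]; exact min_le_left _ _
  have hΘ : π ^ 3 * σ ^ 3 * Θt ≤ 4 := by
    have h1 : σ ^ 3 ≤ σ := by simpa using pow_le_pow_of_le_one hσ0.le hσ1 (by norm_num : 1 ≤ 3)
    have h2 : σ ≤ 4 / (π ^ 3 * Θt + 4) := by rw [hσ]; exact min_le_right _ _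
    have h3 : π ^ 3 * (4 / (π ^ 3 * Θt + 4)) * Θt ≤ 4 := by
      rw [mul_div_assoc', div_mul_eq_mul_div, div_le_iff₀ (by positivity)]; nlinarith only [hΘt0, pow_pos hπ 3]
    calc π ^ 3 * σ ^ 3 * Θt ≤ π ^ 3 * σ * Θt := by gcongr
      _ ≤ π ^ 3 * (4 / (π ^ 3 * Θt + 4)) * Θt := by gcongr
      _ ≤ 4 := h3
  -- the scale-free amplitude constant of `covTel_amp_pack` and the final constant
  -- the step constant (`famTel_increment_scalar_le'` with the covariance slot `0`, `g := G₀`, `Dc := 1/(Λ·4^i)`, `U := 1`) and the weight rate `min ρ σ`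
  obtain ⟨𝒦, h𝒦⟩ : ∃ y : ℝ, y = Real.sqrt (48 * (1048576 * ((1 + 4 * Real.sqrt 2) ^ 2 * ((2 * Real.sqrt 2 / ρ + 2) * (2 * Real.sqrt 2 / ρ₃ + 2)) + (1 / ρ + 1) ^ 2) / σ) *
      (128 * (4 + (4 + 4 * A) * cρ ^ 2 * π ^ 2 / klE0) * cρ / (π ^ 2 * (2 * B.rhomin - 4 * A)) * (16 : ℝ) ^ j)) * (288 * (20 * (d₀ * klE0 ^ 2)) / (4 : ℝ) ^ (j + 1)) := ⟨_, rfl⟩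
  have hS0 : 0 < Real.sqrt (48 * (1048576 * ((1 + 4 * Real.sqrt 2) ^ 2 * ((2 * Real.sqrt 2 / ρ + 2) * (2 * Real.sqrt 2 / ρ₃ + 2)) + (1 / ρ + 1) ^ 2) / σ) *
      (128 * (4 + (4 + 4 * A) * cρ ^ 2 * π ^ 2 / klE0) * cρ / (π ^ 2 * (2 * B.rhomin - 4 * A)) * (16 : ℝ) ^ j)) := Real.sqrt_pos.2 (by positivity)
  have h𝒦0 : 0 ≤ 𝒦 := by rw [h𝒦]; positivity
  refine ⟨𝒦, min ρ σ, h𝒦0, lt_min hρ0 hσ0, ?_⟩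
  intro R hR c U hc hcle hU hUle hG3U β hβmin hβc μ hμ L M _ _ hLβ hMβ Ko Kn i hfro hfrn h3o h3n _ hl3n G₀ hG₀pos hG₀1 hw₀ hw₁ hw₂ hw₃ m hnfN hwin nw hnw
  have hβ0 : 0 < β := pos_of_klBetaMin_le hβmin
  have hβ128 : 128 ≤ β := by simpa [klBetaMin] using hβmin
  have hL0 : (0 : ℝ) < L := lt_of_lt_of_le (by positivity) hLβ
  have hL1r : (1 : ℝ) ≤ L := le_trans (one_le_pow₀ (by linarith only [hβ128] : (1 : ℝ) ≤ β)) hLβ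
  have hM0 : (0 : ℝ) < M := lt_of_lt_of_le hβ0 hMβ
  have hU1 : U ≤ 1 := hUle.trans (min_le_left _ _)
  have hU2 : U ^ 2 ≤ 1 := pow_le_one₀ hU.le hU1
  -- the capped order-three slope `Gfr₃ U² ≤ 1`
  have hG3U2 : R.Gfr 3 * U ^ 2 ≤ 1 := by
    calc R.Gfr 3 * U ^ 2 = (R.Gfr 3 * U) * U := by ring
      _ ≤ 1 * 1 := mul_le_mul hG3U hU1 hU.le zero_le_one
      _ = 1 := one_mul _
  have hR3 : 0 ≤ R.Gfr 3 := hR 3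
  -- the frames' `C²` size is `≤ A = κ₀/4`
  have hlog : 1 ≤ Real.log 4 := by
    have h4 : Real.exp 1 ≤ 4 := by have := Real.exp_one_lt_d9; norm_num at this; linarith
    calc (1 : ℝ) = Real.log (Real.exp 1) := (Real.log_exp 1).symm
      _ ≤ Real.log 4 := Real.log_le_log (Real.exp_pos 1) h4
  have hAK : ∀ K : TrigPolyC4v, FrameOK R U (nScales β) μ K → ∀ p : Momentum, ∀ k ≤ 2, ‖iteratedFDeriv ℝ k (frameShift K) p‖ ≤ A := by
    intro K hK p k hk
    refine (norm_iteratedFDeriv_frameShift_le_of_frameOK_regime hR hc.le hβmin hβc hK p hk).trans ?_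
    have h0 := hR 0; have h1 := hR 1; have h2 := hR 2
    have hUk : U ≤ κ₀ / (24 * (R.Gfr 0 + R.Gfr 1 + 1)) := hUle.trans (min_le_right _ _)
    rw [abs_of_pos hU]
    have hU2' : U ^ 2 ≤ U := by nlinarith only [hU, hU1]
    have hA1 : 2 * R.Gfr 0 * U + 2 * R.Gfr 1 * U ^ 2 ≤ 2 * (R.Gfr 0 + R.Gfr 1 + 1) * U := by
      have := mul_le_mul_of_nonneg_left hU2' h1
      linarith only [this, hU.le]
    have hB1 : 2 * (R.Gfr 0 + R.Gfr 1 + 1) * U ≤ κ₀ / 12 := by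
      have hpos : 0 < 24 * (R.Gfr 0 + R.Gfr 1 + 1) := by positivity
      have := (le_div_iff₀ hpos).mp hUk
      linarith only [this]
    have hC1 : R.Gfr 2 * (c / Real.log 4) ≤ R.Gfr 2 * c := mul_le_mul_of_nonneg_left (div_le_self hc.le hlog) h2
    have hD1 : R.Gfr 2 * c ≤ κ₀ / 12 := by
      have hpos : 0 < 12 * (R.Gfr 2 + 1) := by positivity
      have := (le_div_iff₀ hpos).mp hcle
      linarith only [this, hc.le]
    rw [hAdef]; linarith only [hA1, hB1, hC1, hD1, hκ₀pos]
  have hAo := hAK Ko hfro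
  have hAn := hAK Kn hfrn
  have hμ' := hμ
  simp only [klWindowC, Set.mem_Icc] at hμ'
  have hμlo : -(21 / 20 : ℝ) ≤ μ := by rw [← show (-1.05 : ℝ) = -(21 / 20) by norm_num]; exact hμ'.1
  have hμhi : μ ≤ -(3 / 20 : ℝ) := by rw [← show (-0.15 : ℝ) = -(3 / 20) by norm_num]; exact hμ'.2
  have he0 : klE0 = 1 / 32 := rfl
  have hgap : klE0 + A + (1 / 10 : ℝ) ^ 2 < -μ := by rw [he0, hAdef]; linarith only [hμhi, hκ₀40]
  have h3 : klE0 + A - μ ≤ 3 := by rw [he0, hAdef]; linarith only [hμlo, hκ₀40]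
  have hlo : (-(6 / 5) : ℝ) ≤ μ - A - klE0 := by rw [he0, hAdef]; linarith only [hμlo, hκ₀40]
  have hhi : μ + A + klE0 ≤ -(1 / 10) := by rw [he0, hAdef]; linarith only [hμhi, hκ₀40]
  have hADt : 2 * A < B.Dtmin := by rw [hAdef]; linarith
  have hρA : 4 * A < 2 * B.rhomin := by rw [hAdef]; linarith
  have hK₂o : ∀ p, ‖iteratedFDeriv ℝ 2 (frameLevel μ Ko) p‖ ≤ 7 := fun p => norm_iteratedFDeriv_two_frameLevel_le_of_frameOK hfro p
  have hK₁n : ∀ p, ‖fderiv ℝ (frameLevel μ Kn) p‖ ≤ 7 := fun p => norm_fderiv_frameLevel_le_of_frameOK hfrn p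
  have hK₂n : ∀ p, ‖iteratedFDeriv ℝ 2 (frameLevel μ Kn) p‖ ≤ 7 := fun p => norm_iteratedFDeriv_two_frameLevel_le_of_frameOK hfrn p
  have hB₁ : ∀ x, |deriv salmhoferCutoff x| ≤ 32 / 3 := klcd_abs_deriv_salmhoferCutoff_le_sharp
  have hB₂ : ∀ x, |deriv (deriv salmhoferCutoff) x| ≤ 448 / 3 * Real.exp 2 := klsd_abs_deriv2_salmhoferCutoff_le
  have hB₃ : ∀ x, |deriv (deriv (deriv salmhoferCutoff)) x| ≤ 44900 := fun x => (kltd_abs_deriv3_salmhoferCutoff_lt x).le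
  -- the regime scalars at depth `m`, offset `j`, reference scale `4^i`
  have hswpos := sectorWidth_pos (m + 1)
  have hanti : ∀ {a b : ℕ}, a ≤ b → klScale klE0 b ≤ klScale klE0 a := fun hab' => by
    unfold klScale; exact mul_le_mul_of_nonneg_left (inv_anti₀ (by positivity) (pow_le_pow_right₀ (by norm_num) hab')) he.le
  obtain ⟨hMm, hM', hπβ, hLN, hL1, hLz2, hL40, hN2⟩ := telRegime_lattice hβmin hLβ hMβ hnfN hγ4
  obtain ⟨hlamΛ, hΛ₁, hNΛ, hx₀W, hY1, hY, hYW, hΛW, hΛx, hlx2, hlx, hlam1, hΛlam⟩ := telRegime_refscale (m := m) (j := j) (i₀ := i) hwin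
  obtain ⟨hwsi, hζ, hw, hsw⟩ := telRegime_angular m
  have hΛs : 0 < klScale klE0 (m + 1 + j) := klth_klScale_pos _
  have hlam0 : 0 < klScale klE0 m := klth_klScale_pos _
  have hΛe : ∀ k, klScale klE0 k ≤ klE0 := fun k => klScale_le_e0 he.le k
  have hΛs1 : klScale klE0 (m + 1 + j) ≤ 1 := hΛlam.trans hlam1
  have hΛΛ' : klScale klE0 (m + 1 + j) ≤ klScale klE0 (m + j) := hanti (by omega)
  have hx₀1 : (1 : ℝ) ≤ (4 : ℝ) ^ i := one_le_pow₀ (by norm_num)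
  have hx₀0 : (0 : ℝ) < (4 : ℝ) ^ i := by positivity
  -- the capped frame data at depth `4^i`
  have h4s : (4 : ℝ) ^ (i + 1) = (4 : ℝ) ^ i * 4 := pow_succ (4 : ℝ) i
  have h3o' : ∀ p : Momentum, ‖iteratedFDeriv ℝ 3 (frameShift Ko) p‖ ≤ 4 / 3 * (4 : ℝ) ^ i := fun p => (h3o p).trans (by nlinarith only [hG3U2, hx₀0, hR3])
  have h3n' : ∀ p : Momentum, ‖iteratedFDeriv ℝ 3 (frameShift Kn) p‖ ≤ 4 / 3 * (4 : ℝ) ^ i := fun p => (h3n p).trans (by rw [h4s]; nlinarith only [hG3U2, hx₀0, hR3])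
  have hl3n' : ∀ p : Momentum, ‖iteratedFDeriv ℝ 3 (frameLevel μ Kn) p‖ ≤ 64 + 4 / 3 * (4 : ℝ) ^ i := fun p => (hl3n p).trans (by rw [h4s]; nlinarith only [hG3U2, hx₀0, hR3])
  -- the family-side increment `e_{K_o} − e_{K_n}` (sign flipped)
  have hneg : (fun q : Momentum => frameLevel μ Ko q - frameLevel μ Kn q) = -(fun q : Momentum => frameLevel μ Kn q - frameLevel μ Ko q) := by
    funext q; simp only [Pi.neg_apply]; ring
  have hu₀ : ∀ p : Momentum, |frameLevel μ Ko p - frameLevel μ Kn p| ≤ G₀ / ((4 : ℝ) ^ i) ^ 2 := fun p => by rw [abs_sub_comm]; exact hw₀ p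
  have hu₁ : ∀ p : Momentum, ‖fderiv ℝ (fun q : Momentum => frameLevel μ Ko q - frameLevel μ Kn q) p‖ ≤ G₀ / (4 : ℝ) ^ i := fun p => by
    rw [hneg, fderiv_neg, norm_neg]; exact hw₁ p
  have hu₂ : ∀ p : Momentum, ‖iteratedFDeriv ℝ 2 (fun q : Momentum => frameLevel μ Ko q - frameLevel μ Kn q) p‖ ≤ G₀ := fun p => by
    rw [hneg, iteratedFDeriv_neg_apply, norm_neg]; exact hw₂ p
  have hu₃ : ∀ p : Momentum, ‖iteratedFDeriv ℝ 3 (fun q : Momentum => frameLevel μ Ko q - frameLevel μ Kn q) p‖ ≤ G₀ * (4 : ℝ) ^ i := fun p => by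
    rw [hneg, iteratedFDeriv_neg_apply, norm_neg]; exact hw₃ p
  -- the increment constants: all slots `= G₀ ≤ 1`
  have hG₀g : G₀ ≤ 1 := hG₀1
  have hGγ : G₀ = 1 * G₀ := (one_mul G₀).symm
  have hGΛ : G₀ / ((4 : ℝ) ^ i) ^ 2 ≤ klScale klE0 m := by
    rw [div_le_iff₀ (by positivity)]
    have h2 : (1 : ℝ) ≤ klScale klE0 m * ((4 : ℝ) ^ i) ^ 2 := by
      rw [show klScale klE0 m * ((4 : ℝ) ^ i) ^ 2 = (klScale klE0 m * (4 : ℝ) ^ i) * (4 : ℝ) ^ i by ring]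
      exact one_le_mul_of_one_le_of_one_le hlx hx₀1
    linarith
  have hρf0 : 0 ≤ (klScale klE0 m + B.smax * B.Dtmin * (3 * sectorWidth (m + 1) / 4)) / (B.Dtmin - 2 * A) + π * Real.sqrt 2 * (1 + (4 + 2 * A) / (B.Dtmin - 2 * A)) * sectorWidth (m + 1) := by
    positivity
  have hρfb : (klScale klE0 m + B.smax * B.Dtmin * (3 * sectorWidth (m + 1) / 4)) / (B.Dtmin - 2 * A) + π * Real.sqrt 2 * (1 + (4 + 2 * A) / (B.Dtmin - 2 * A)) * sectorWidth (m + 1) ≤ ρfM := by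
    rw [hρfM]; gcongr; exact hΛe m
  have hs₀pos : 0 < σ * klScale klE0 (m + 1 + j) * β / M := by positivity
  have hs₀1 : σ * klScale klE0 (m + 1 + j) * β ≤ M := by
    calc σ * klScale klE0 (m + 1 + j) * β ≤ 1 * 1 * β := by gcongr
      _ = β := by ring
      _ ≤ M := hMβ
  have hP2M : (0 : ℝ) < ((2 * M : ℕ) : ℝ) := by push_cast; positivity
  have hsM' : σ * klScale klE0 (m + 1 + j) * β / M * (2 * (M : ℝ)) ≤ 2 * σ * klScale klE0 (m + 1 + j) * β := by
    rw [show σ * klScale klE0 (m + 1 + j) * β / M * (2 * (M : ℝ)) = 2 * σ * klScale klE0 (m + 1 + j) * β by field_simp]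
  have hsM : σ * klScale klE0 (m + 1 + j) * β / M * ((2 * M : ℕ) : ℝ) ≤ 2 * σ * klScale klE0 (m + 1 + j) * β := by push_cast; exact hsM'
  have hM2 : (0 : ℝ) < 2 * (M : ℝ) := by positivity
  -- the weight scale: `Λ_{n_w}·4^i ≤ min ρ σ` gives the dominations with `D = 1` (family) / `D_w = 4^{−i}` (covariance)
  have hΛnw0 : 0 ≤ klScale klE0 nw := (klth_klScale_pos _).le
  have hnwρ : klScale klE0 nw ≤ ρ / (4 : ℝ) ^ i := by rw [le_div_iff₀ hx₀0]; exact hnw.trans (min_le_left _ _)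
  have hnwσ : klScale klE0 nw ≤ σ * klScale klE0 (m + 1 + j) := by
    have h1 : klScale klE0 nw * (4 : ℝ) ^ i ≤ σ := hnw.trans (min_le_right _ _)
    have h2 : klScale klE0 nw ≤ σ / (4 : ℝ) ^ i := by rw [le_div_iff₀ hx₀0]; exact h1
    refine h2.trans ?_
    rw [div_le_iff₀ hx₀0]
    calc σ = σ * 1 := (mul_one σ).symm
      _ ≤ σ * (klScale klE0 (m + 1 + j) * (4 : ℝ) ^ i) := mul_le_mul_of_nonneg_left hΛx hσ0.le
      _ = σ * klScale klE0 (m + 1 + j) * (4 : ℝ) ^ i := by ring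
  have hdom₀ : klScale klE0 nw * β / (2 * M) ≤ 1 * (σ * klScale klE0 (m + 1 + j) * β / M) := by
    rw [one_mul, div_le_div_iff₀ (by positivity) hM0]
    have h1 : klScale klE0 nw * β * M ≤ σ * klScale klE0 (m + 1 + j) * β * M := by gcongr
    have h2 : 0 ≤ σ * klScale klE0 (m + 1 + j) * β * M := by positivity
    linarith only [h1, h2]
  have hdom₁ : klScale klE0 nw ≤ 1 * (ρ / (4 : ℝ) ^ i) := by rw [one_mul]; exact hnwρ
  have hs2 : Real.sqrt 2 ≤ 2 := by rw [show (2 : ℝ) = Real.sqrt 4 by rw [show (4:ℝ) = 2^2 by norm_num, Real.sqrt_sq (by norm_num)]]; exact Real.sqrt_le_sqrt (by norm_num)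
  have hℓ25 : 2 * π / (L : ℝ) * ((2 : ℝ) + 1 / 2) ≤ 1 / 30 := by rw [← abs_of_pos (by positivity : (0 : ℝ) < 2 * π / L)]; linarith only [hLz2]
  have hcast : ((2 * M : ℕ) : ℝ) = 2 * (M : ℝ) := by push_cast; ring
  have htvb : (4 + 2 * A) / (2 - 1) + 7 * (Real.sqrt 2 * ((klScale klE0 m + B.smax * B.Dtmin * (3 * sectorWidth (m + 1) / 4)) / (B.Dtmin - 2 * A) +
      π * Real.sqrt 2 * (1 + (4 + 2 * A) / (B.Dtmin - 2 * A)) * sectorWidth (m + 1))) + G₀ / (4 : ℝ) ^ i ≤ bs := by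
    have h1 : G₀ / (4 : ℝ) ^ i ≤ 1 := (div_le_self hG₀pos.le hx₀1).trans hG₀1
    have h7ρ : 7 * (Real.sqrt 2 * ((klScale klE0 m + B.smax * B.Dtmin * (3 * sectorWidth (m + 1) / 4)) / (B.Dtmin - 2 * A) +
        π * Real.sqrt 2 * (1 + (4 + 2 * A) / (B.Dtmin - 2 * A)) * sectorWidth (m + 1))) ≤ 7 * (Real.sqrt 2 * ρfM) := by gcongr
    rw [hbs, hT₀]; linarith
  have htT : (4 + 2 * A) ≤ T₀ := by rw [hT₀]; norm_num; positivity
  have htvT : (4 + 2 * A) / (2 - 1) + 7 * (Real.sqrt 2 * ((klScale klE0 m + B.smax * B.Dtmin * (3 * sectorWidth (m + 1) / 4)) / (B.Dtmin - 2 * A) +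
      π * Real.sqrt 2 * (1 + (4 + 2 * A) / (B.Dtmin - 2 * A)) * sectorWidth (m + 1))) ≤ T₀ := by
    have h7ρ : 7 * (Real.sqrt 2 * ((klScale klE0 m + B.smax * B.Dtmin * (3 * sectorWidth (m + 1) / 4)) / (B.Dtmin - 2 * A) +
        π * Real.sqrt 2 * (1 + (4 + 2 * A) / (B.Dtmin - 2 * A)) * sectorWidth (m + 1))) ≤ 7 * (Real.sqrt 2 * ρfM) := by gcongr
    rw [hT₀]; linarith
  have hLe : 7 * (2 * π / (L : ℝ)) ≤ bs := by
    have : 2 * π / (L : ℝ) ≤ 2 * π / (L : ℝ) * ((2 : ℝ) + 1 / 2) := le_mul_of_one_le_right (by positivity) (by norm_num)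
    linarith only [this, hℓ25, h7bs]
  have hLv : 7 * (2 * π / (L : ℝ) * (Real.sqrt 2 * ((2 : ℝ) + 1 / 2))) ≤ bs := by
    have : 2 * π / (L : ℝ) * (Real.sqrt 2 * ((2 : ℝ) + 1 / 2)) ≤ 2 * (2 * π / (L : ℝ) * ((2 : ℝ) + 1 / 2)) := by
      rw [show 2 * π / (L : ℝ) * (Real.sqrt 2 * ((2 : ℝ) + 1 / 2)) = Real.sqrt 2 * (2 * π / (L : ℝ) * ((2 : ℝ) + 1 / 2)) by ring]
      exact mul_le_mul_of_nonneg_right hs2 (by positivity)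
    linarith only [this, hℓ25, h7bs]
  -- the thresholds and the time condition at the reference scale `x₀ := 4^i`
  have hpack := famTel_thresholds_pack (lam := klScale klE0 m) (e₀ := klE0) (d := d₀) (Ba3 := B₃a) (Λ := klScale klE0 (m + 1 + j)) (c := β * (L : ℝ) ^ 2) (β := β) (P2M := ((2 * M : ℕ) : ℝ))
    (x₀ := (4 : ℝ) ^ i) (T₀ := T₀) (E₀ := 4) (E₁ := 32 / 3) (zc := 1) (g₀ := 1) (g₁ := 1) (g₂ := 1) (g₃ := 1) (γ₁ := 1) (γ₂ := 1) (γ₃ := 1) (Q := Q) (Y := 1 / klScale klE0 m ^ 2)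
    (W := (4 : ℝ) ^ (j + 1) * (1 / klScale klE0 m ^ 2)) (ρ := ρ) (ρ₃ := ρ₃) (σ := σ) (s₀ := σ * klScale klE0 (m + 1 + j) * β / M) (ℭ := ℭ) (𝔴 := 𝔴)
    (A := A) (ε₂ := 4 + 4 * A) (ε₃₀ := 4) (ε₃₁ := 32 / 3) (b₂ := 7) (b₂' := 0) (b₃ := 64) (b₃' := 4 / 3) (B₁ := 32 / 3) (B₂ := 448 / 3 * Real.exp 2) (B₃ := 44900)
    (t := 4 + 2 * A) (G₀ := G₀) (Gi₁ := G₀) (Gi₂ := G₀) (Gi₃ := G₀) (ζ := 1 + 6 * (sectorWidth (m + 1))⁻¹) (κ := klE0 ^ 2 / klScale klE0 m ^ 2)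
    (tv := (4 + 2 * A) / (2 - 1) + 7 * (Real.sqrt 2 * ((klScale klE0 m + B.smax * B.Dtmin * (3 * sectorWidth (m + 1) / 4)) / (B.Dtmin - 2 * A) +
      π * Real.sqrt 2 * (1 + (4 + 2 * A) / (B.Dtmin - 2 * A)) * sectorWidth (m + 1))))
    (h𝔮₁ := rfl) (h𝔮₂ := rfl) (h𝔮₃₀ := rfl) (h𝔮₃₁ := rfl) (hd₁ := rfl) (hw₁ := rfl) (hd₂ := rfl) (hw₂ := rfl) (hd₃₀ := rfl) (hd₃₁ := rfl) (hw₃₀ := rfl) (hw₃₁ := rfl) (ho₁₀ := rfl) (ho₁₁ := rfl) (ho₂₀ := rfl) (ho₂₁ := rfl)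
    (ho₂₂ := rfl) (ho₃₀ := rfl) (ho₃₁ := rfl) (ho₃₂ := rfl) (ho₃₃ := rfl) (hR₁₀ := rfl) (hR₁₁ := rfl) (hR₂₀ := rfl) (hR₂₁ := rfl) (hR₂₂ := rfl) (hR₃₀ := rfl) (hR₃₁ := rfl) (hR₃₂ := rfl) (hR₃₃ := rfl) (hr₁₀ := rfl) (hr₁₁ := rfl)
    (hr₂₀ := rfl) (hr₂₁ := rfl) (hr₂₂ := rfl) (hr₃₀ := rfl) (hr₃₁ := rfl) (hr₃₂ := rfl) (hr₃₃ := rfl) (h𝔳₁ := rfl) (h𝔳₂ := rfl) (h𝔳₃₀ := rfl) (h𝔳₃₁ := rfl) (hdv₁ := rfl) (hwv₁ := rfl) (hdv₂ := rfl) (hwv₂ := rfl) (hdv₃₀ := rfl)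
    (hdv₃₁ := rfl) (hwv₃₀ := rfl) (hwv₃₁ := rfl) (hov₁₀ := rfl) (hov₁₁ := rfl) (hov₂₀ := rfl) (hov₂₁ := rfl) (hov₂₂ := rfl) (hov₃₀ := rfl) (hov₃₁ := rfl) (hov₃₂ := rfl) (hov₃₃ := rfl) (hRv₁₀ := rfl) (hRv₁₁ := rfl) (hRv₂₀ := rfl)
    (hRv₂₁ := rfl) (hRv₂₂ := rfl) (hRv₃₀ := rfl) (hRv₃₁ := rfl) (hRv₃₂ := rfl) (hRv₃₃ := rfl) (hrv₁₀ := rfl) (hrv₁₁ := rfl) (hrv₂₀ := rfl) (hrv₂₁ := rfl) (hrv₂₂ := rfl) (hrv₃₀ := rfl) (hrv₃₁ := rfl) (hrv₃₂ := rfl) (hrv₃₃ := rfl)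
    (hqt₁ := rfl) (hqt₂ := rfl) (hqt₃ := rfl) (hDt₁ := rfl) (hDt₂ := rfl) (hθ₁ := rfl) (hθ₂ := rfl) (hθ₃ := rfl) (hk₁ := rfl) (hk₂ := rfl) (hk₃ := rfl) (hC₀ := rfl) (hC₁' := rfl) (hC₂ := rfl) (hC₃ := rfl) (hCv₀ := rfl) (hCv₁ := rfl)
    (hCv₂ := rfl) (hCv₃ := rfl) (hCw₀ := rfl) (hCw₁ := rfl) (hCw₂ := rfl) (hKc := rfl) (hKw := rfl) (hlam := hlam0) (hlam1 := hlam1) (hY1 := hY1) (hY := hY) (hY2 := le_rfl) (ht0 := (by positivity)) (htT := htT) (htv0 := (by positivity))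
    (htvT := htvT) (hG₀ := hG₀pos) (hG₀g := hG₀g) (hG₁γ := hGγ) (hG₂γ := hGγ) (hG₃γ := hGγ) (hG₁g := hG₀g) (hG₂g := hG₀g) (hG₃g := hG₀g) (hζ0 := (by positivity)) (hζY := hζ) (hε₃₀0 := (by norm_num))
    (hε₃₀E := le_rfl) (hε₃₁0 := (by norm_num)) (hε₃₁E := le_rfl) (hκe := rfl) (hQ := hQ) (hΛ := hΛs) (hΛlam := hΛlam) (hc := (by positivity)) (hβ := hβ0) (hYW := hYW) (hΛW := hΛW) (hQ0 := hQ0) (hρ := hρ0) (hρ₃ := hρ₃0)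
    (hx₀ := hx₀W) (hbs := hbs0) (hb₂ := (by norm_num)) (hb₂' := le_rfl) (hb₃ := (by norm_num)) (hb₃' := (by norm_num)) (hB₁ := (by norm_num)) (hB₂ := (by positivity)) (hB₃ := (by norm_num)) (hℭ := hℭ) (h𝔴 := h𝔴) (hρℭ := hρℭ) (hρ𝔴 := hρ𝔴)
    (hd := hd₀) (hs₀ := hs₀pos) (hP2M := hP2M) (hσ := hσ0) (hsM := hsM) (hΘ := (by rw [← hΘt]; exact hΘ))
  -- the FAMILY piece (p597679 at `(K, K′) := (K_n, K_o)`, `D := 1`)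
  obtain ⟨hFrow, hFcol⟩ := rowSumWt_sliceCT_familySub_bgmFat_le (B := B) (K := Kn) (K' := Ko) (A := A) (A₃ := 4 / 3 * (4 : ℝ) ^ i) (hA := hAn) (hA3 := h3n') (hA' := hAo) (hA3' := h3o') (hADt := hADt)
    (e₀ := klE0) (z := 1 / 10) (he := he) (hz := (by norm_num : (0 : ℝ) < 1 / 10)) (hz1 := (by norm_num : (1 / 10 : ℝ) ≤ 1)) (hgap := hgap) (h3 := h3) (hlo := hlo) (hhi := hhi) (hβ := hβ0) (hρA := hρA) (m := m) (hMm := hMm)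
    (d := d₀) (hd := hd₀) (hd1 := hd₀1) (hd2 := hd₀2) (hd3 := hd₀3) (hd4 := hd₀4) (Ba := B₃a) (hB0 := hB₃a0) (hB := hB₃a) (K₂ := 7) (hK₂ := hK₂n) (hK₂' := hK₂o) (Nr := 2) (hNr := (le_refl (2 : ℝ))) (hLz := hLz2)
    (x := (4 : ℝ) ^ i) (G₀ := G₀) (G₁ := G₀) (G₂ := G₀) (G₃ := G₀) (ε₃₀ := 4) (ε₃₁ := 32 / 3) (hx := hx₀1) (hG₀ := hG₀pos) (hG₁ := hG₀pos.le) (hG₂ := hG₀pos.le) (hG₃ := hG₀pos.le) (hε₃₀ := (by norm_num))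
    (hε₃₁ := (by norm_num)) (hv₀ := hu₀) (hv₁ := hu₁) (hv₂ := hu₂) (hv₃ := hu₃) (hGΛ := hGΛ) (hA₃x := le_of_eq (by ring)) (Λ := klScale klE0 (m + 1 + j)) (Λ' := klScale klE0 (m + j)) (hΛ := hΛs) (hΛΛ' := hΛΛ') (hM' := hM')
    (Kb₁ := 7) (Kb₂ := 7) (Kb₃ := 64 + 4 / 3 * (4 : ℝ) ^ i) (hKb₁ := hK₁n) (hKb₂ := hK₂n) (hKb₃ := hl3n') (bs := bs) (b₂ := 7) (b₂' := 0) (b₃ := 64) (b₃' := 4 / 3) (hbs := hbs0) (hKb₁b := h7bs) (hKb₂x := (by linarith only [hx₀0]))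
    (hKb₃x := le_rfl) (B₁ := 32 / 3) (B₂ := 448 / 3 * Real.exp 2) (B₃ := 44900) (hB₁ := hB₁) (hB₂ := hB₂) (hB₃ := hB₃) (hρf := rfl) (hκ := rfl) (hC₁ := rfl) (hB₀x := rfl) (hε₂ := rfl) (hζ := rfl) (ht := rfl) (h𝔮₁ := rfl) (h𝔮₂ := rfl) (h𝔮₃₀ := rfl)
    (h𝔮₃₁ := rfl) (hd₁ := rfl) (hw₁ := rfl) (hd₂ := rfl) (hw₂ := rfl) (hd₃₀ := rfl) (hd₃₁ := rfl) (hw₃₀ := rfl) (hw₃₁ := rfl) (ho₁₀ := rfl) (ho₁₁ := rfl) (ho₂₀ := rfl) (ho₂₁ := rfl) (ho₂₂ := rfl) (ho₃₀ := rfl) (ho₃₁ := rfl) (ho₃₂ := rfl)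
    (ho₃₃ := rfl) (hR₁₀ := rfl) (hR₁₁ := rfl) (hR₂₀ := rfl) (hR₂₁ := rfl) (hR₂₂ := rfl) (hR₃₀ := rfl) (hR₃₁ := rfl) (hR₃₂ := rfl) (hR₃₃ := rfl) (hr₁₀ := rfl) (hr₁₁ := rfl) (hr₂₀ := rfl) (hr₂₁ := rfl) (hr₂₂ := rfl) (hr₃₀ := rfl) (hr₃₁ := rfl)
    (hr₃₂ := rfl) (hr₃₃ := rfl) (htv := rfl) (h𝔳₁ := rfl) (h𝔳₂ := rfl) (h𝔳₃₀ := rfl) (h𝔳₃₁ := rfl) (hdv₁ := rfl) (hwv₁ := rfl) (hdv₂ := rfl) (hwv₂ := rfl) (hdv₃₀ := rfl) (hdv₃₁ := rfl) (hwv₃₀ := rfl) (hwv₃₁ := rfl) (hov₁₀ := rfl) (hov₁₁ := rfl)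
    (hov₂₀ := rfl) (hov₂₁ := rfl) (hov₂₂ := rfl) (hov₃₀ := rfl) (hov₃₁ := rfl) (hov₃₂ := rfl) (hov₃₃ := rfl) (hRv₁₀ := rfl) (hRv₁₁ := rfl) (hRv₂₀ := rfl) (hRv₂₁ := rfl) (hRv₂₂ := rfl) (hRv₃₀ := rfl) (hRv₃₁ := rfl) (hRv₃₂ := rfl) (hRv₃₃ := rfl)
    (hrv₁₀ := rfl) (hrv₁₁ := rfl) (hrv₂₀ := rfl) (hrv₂₁ := rfl) (hrv₂₂ := rfl) (hrv₃₀ := rfl) (hrv₃₁ := rfl) (hrv₃₂ := rfl) (hrv₃₃ := rfl) (hqt₁ := rfl) (hqt₂ := rfl) (hqt₃ := rfl) (hDt₁ := rfl) (hDt₂ := rfl) (hθ₁ := rfl) (hθ₂ := rfl) (hθ₃ := rfl)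
    (htvb := htvb) (hLe := hLe) (hLv := hLv) (s₀ := σ * klScale klE0 (m + 1 + j) * β / M) (ρ := ρ) (ρ₃ := ρ₃) (hs₀ := hs₀pos) (hρ := hρ0) (hρ₃ := hρ₃0) (hk₁ := rfl) (hk₂ := rfl) (hk₃ := rfl) (htime := hpack.2) (hC₀ := rfl) (hC₁' := rfl)
    (hC₂ := rfl) (hC₃ := rfl) (hCv₀ := rfl) (hCv₁ := rfl) (hCv₂ := rfl) (hCv₃ := rfl) (hCw₀ := rfl) (hCw₁ := rfl) (hCw₂ := rfl) (hKc := rfl) (hKw := rfl) (th₃ := hpack.1.1.1) (th₂ := hpack.1.1.2.1) (th₁ := hpack.1.1.2.2.1) (th₀ := hpack.1.1.2.2.2)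
    (tv₃ := hpack.1.2.1.1) (tv₂ := hpack.1.2.1.2.1) (tv₁ := hpack.1.2.1.2.2.1) (tv₀ := hpack.1.2.1.2.2.2) (tw₂ := hpack.1.2.2.1) (tw₁ := hpack.1.2.2.2.1) (tw₀ := hpack.1.2.2.2.2) (nw := nw) (D := 1) (hD := le_rfl)
    (hdom₀ := hdom₀) (hdom₁ := hdom₁)
  -- the step scalar (`famTel_increment_scalar_le'` with covariance slot `0`, `g := G₀`, `Dc := 1/(Λ·4^i)`, `U := 1`)
  have hincr := famTel_increment_scalar_le' (j := j) (m := m) (x₀ := (4 : ℝ) ^ i) (Dw := 1 / (4 : ℝ) ^ i) (Dc := 1 / (klScale klE0 (m + 1 + j) * (4 : ℝ) ^ i)) (U := 1) (g := G₀) (AΔs := 0) (𝒜 := 0)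
    B hA0.le hγ hDtA he hd₀ hΛs hΛs1 hΛ₁ hlamΛ hβ0 hL0 hM0 hN2 hπβ hNΛ hw rfl hcρ rfl rfl hLN hL1 hσ0 rfl hs₀1 hρ0 hρ₃0
    hx₀1 (by positivity) (by positivity) (le_of_eq (by field_simp)) hG₀pos.le hG₀pos.le (by rw [one_pow, mul_one]) le_rfl (by rw [mul_zero])
  simp only [mul_zero, add_zero] at hincr
  rw [hcast] at hFrow hFcol
  -- the family amplitude: `x²·𝔅₀(x) ≤ C₁·G₀·5Λ_m`
  have hC₁0 : 0 ≤ d₀ * klE0 ^ 2 / klScale klE0 m ^ 2 := by positivity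
  have hB₀x' : ((4 : ℝ) ^ i) ^ 2 * (d₀ * klE0 ^ 2 / klScale klE0 m ^ 2 * (G₀ / ((4 : ℝ) ^ i) ^ 2 * (2 * (klScale klE0 m + G₀ / ((4 : ℝ) ^ i) ^ 2) + G₀ / ((4 : ℝ) ^ i) ^ 2))) ≤
      d₀ * klE0 ^ 2 / klScale klE0 m ^ 2 * (G₀ * (5 * klScale klE0 m)) := by
    have e : ((4 : ℝ) ^ i) ^ 2 * (d₀ * klE0 ^ 2 / klScale klE0 m ^ 2 * (G₀ / ((4 : ℝ) ^ i) ^ 2 * (2 * (klScale klE0 m + G₀ / ((4 : ℝ) ^ i) ^ 2) + G₀ / ((4 : ℝ) ^ i) ^ 2))) =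
        d₀ * klE0 ^ 2 / klScale klE0 m ^ 2 * (G₀ * (2 * klScale klE0 m + 3 * (G₀ / ((4 : ℝ) ^ i) ^ 2))) := by
      field_simp; ring
    rw [e]
    exact mul_le_mul_of_nonneg_left (mul_le_mul_of_nonneg_left (by linarith only [hGΛ]) hG₀pos.le) hC₁0
  -- abbreviate the common radicals
  set W : ℝ := Real.sqrt (524288 * (1 / (σ * klScale klE0 (m + 1 + j) * β / M) + 1) * ((1 + 4 * Real.sqrt 2) ^ 2 * ((2 * Real.sqrt 2 / ρ + 2) * (2 * Real.sqrt 2 / ρ₃ + 2)) + (1 / ρ + 1) ^ 2)) with hWdef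
  set N : ℝ := Real.sqrt (24 * (2 * (M : ℝ)) * (L : ℝ) ^ 2 * ((klScale klE0 m * β / π + 1) *
    ((Real.sqrt 2 * L * ((klScale klE0 m + (4 + 4 * A) * ((klScale klE0 m + B.smax * B.Dtmin * (3 * sectorWidth (m + 1) / 4)) / (B.Dtmin - 2 * A) +
      π * Real.sqrt 2 * (1 + (4 + 2 * A) / (B.Dtmin - 2 * A)) * sectorWidth (m + 1)) ^ 2) / (2 * B.rhomin - 4 * A)) / π + 2) *
    (Real.sqrt 2 * L * (2 * ((klScale klE0 m + B.smax * B.Dtmin * (3 * sectorWidth (m + 1) / 4)) / (B.Dtmin - 2 * A) +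
      π * Real.sqrt 2 * (1 + (4 + 2 * A) / (B.Dtmin - 2 * A)) * sectorWidth (m + 1))) / π + 2)))) with hNdef
  have hW0 : 0 ≤ W := Real.sqrt_nonneg _
  have hN0 : 0 ≤ N := Real.sqrt_nonneg _
  have hA₀ : 0 ≤ (1 / (β * (L : ℝ) ^ 2)) ^ 2 * (4 * (β * (L : ℝ) ^ 2) / klScale klE0 (m + 1 + j)) := by positivity
  have keyF : 1 * (2 * ((4 : ℝ) ^ i * W * N * (d₀ * klE0 ^ 2 / klScale klE0 m ^ 2 * (G₀ / ((4 : ℝ) ^ i) ^ 2 * (2 * (klScale klE0 m + G₀ / ((4 : ℝ) ^ i) ^ 2) + G₀ / ((4 : ℝ) ^ i) ^ 2)) *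
        ((1 / (β * (L : ℝ) ^ 2)) ^ 2 * (4 * (β * (L : ℝ) ^ 2) / klScale klE0 (m + 1 + j)))))) ≤
      1 / (4 : ℝ) ^ i * (2 * (W * N * (d₀ * klE0 ^ 2 / klScale klE0 m ^ 2 * (G₀ * (5 * klScale klE0 m)) * ((1 / (β * (L : ℝ) ^ 2)) ^ 2 * (4 * (β * (L : ℝ) ^ 2) / klScale klE0 (m + 1 + j)))))) := by
    have e : 1 * (2 * ((4 : ℝ) ^ i * W * N * (d₀ * klE0 ^ 2 / klScale klE0 m ^ 2 * (G₀ / ((4 : ℝ) ^ i) ^ 2 * (2 * (klScale klE0 m + G₀ / ((4 : ℝ) ^ i) ^ 2) + G₀ / ((4 : ℝ) ^ i) ^ 2)) *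
        ((1 / (β * (L : ℝ) ^ 2)) ^ 2 * (4 * (β * (L : ℝ) ^ 2) / klScale klE0 (m + 1 + j)))))) =
        1 / (4 : ℝ) ^ i * (2 * (W * N * ((((4 : ℝ) ^ i) ^ 2 * (d₀ * klE0 ^ 2 / klScale klE0 m ^ 2 * (G₀ / ((4 : ℝ) ^ i) ^ 2 * (2 * (klScale klE0 m + G₀ / ((4 : ℝ) ^ i) ^ 2) + G₀ / ((4 : ℝ) ^ i) ^ 2)))) *
          ((1 / (β * (L : ℝ) ^ 2)) ^ 2 * (4 * (β * (L : ℝ) ^ 2) / klScale klE0 (m + 1 + j)))))) := by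
      field_simp
    rw [e]
    exact mul_le_mul_of_nonneg_left (mul_le_mul_of_nonneg_left (mul_le_mul_of_nonneg_left (mul_le_mul_of_nonneg_right hB₀x' hA₀) (mul_nonneg hW0 hN0)) (by norm_num)) (by positivity)
  have efin : ∀ S T : ℝ, S * G₀ * (1 / (klScale klE0 (m + 1 + j) * (4 : ℝ) ^ i)) * T * (1 : ℝ) ^ 2 * ((M : ℝ) / β) / klScale klE0 (m + 1 + j) =
      S * T * G₀ * ((M : ℝ) / β) / (klScale klE0 (m + 1 + j) ^ 2 * (4 : ℝ) ^ i) := fun S T => by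
    field_simp
  rw [efin, ← h𝒦] at hincr
  refine ⟨fun Y => ?_, fun Y' => ?_⟩
  · have h1 := (hFrow Y).trans (mul_le_mul_of_nonneg_left (mul_le_mul_of_nonneg_left keyF (by norm_num)) (by norm_num))
    linarith only [h1, hincr]
  · have h1 := (hFcol Y').trans (mul_le_mul_of_nonneg_left (mul_le_mul_of_nonneg_left keyF (by norm_num)) (by norm_num))
    linarith only [h1, hincr]

end Summit.HubbardSuperconductivity.HubbardSuperconductivity.Theorems.TorusFourierL2

end
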